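import Summits.QuantumFields.YangMills.Theorems.PoincareLipschitzIteratedOfAvgStabilityModGauge
import HarnessLib

/-!
# Crux stmt-QuantumFields-19936 `UnitScaleTilt.HistoryTailL`, K2 at depth (route crux `PoincareLipschitz.BlockLipschitzL`, stmt-QuantumFields-23533,
# registered stub `stub_iteratedLipschitz`): the displayed row «AVERAGE STABILITY MODULO GAUGE» of the K2-TOP door REDUCED TO ORBIT-MINIMISING PAIRS

The door ✓`PoincareLipschitzIteratedOfAvgStability.stub_iteratedLipschitz_of_avgStabilityModGauge` (w1 g7) derives the registered `j ≥ 2` stub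
`stub_iteratedLipschitz` VERBATIM from ONE displayed row: for locally hierarchically small pairs `(U, U')` of level-zero `SU(2)` fields around a
level-`(j+1)` plaquette `a`, SOME level-`j` gauge copy of `Ū^j(U')` is within `CS/√(L^{j+1})·‖X(U,U')‖` of `Ū^j(U)` in `dist1` on the two-block
footprints of `∂a`, where `‖X(U,U')‖² = Σ_{b ∈ box} dist1(U_b U'_b⁻¹)²` is the box `ℓ²` link distance.

THE POINT OF THIS FILE.  The LEFT side of that row is EXACTLY invariant under re-gauging `U'` at level zero — `Ū^j(U'^k) = (Ū^j U')^{k↑}`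
(✓`T4Continuum.iter_gaugeAct`, `k↑ = transfUp k j`), absorbed by `h ↦ h·k↑` — and so is the local goodness of `U'` (`dist1` of a conjugated
plaquette), while the RIGHT side `‖X(U, U'^k)‖` is NOT.  Hence the row is EQUIVALENT to its restriction to pairs in which `U'` is a box-`ℓ²`-CLOSEST
POINT OF ITS OWN LEVEL-ZERO GAUGE ORBIT to `U` (`∀ k, ‖X(U,U')‖² ≤ ‖X(U,U'^k)‖²`): a minimiser exists because `k ↦ ‖X(U,U'^k)‖²` is continuous on
the compact group `(Site → SU(2))` (`exists_orbitMinimiser`), the `k = 1` competitor gives `‖X(U,U'^{k⋆})‖ ≤ ‖X(U,U')‖`, and the gauge copy found for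
the minimising pair is transported back by `h·k⋆↑`.  In other words the honest content of K2 at depth is the Lipschitz property of the gauge class of the
footprint of `Ū^j` for the `ℓ²`-QUOTIENT metric `d(U', orbit U)` — `avgStabilityModGauge_of_orbitMinimising` (§2) and, through the door, the registered
stub (`stub_iteratedLipschitz_of_avgStabilityOrbitMin`, §3).

WHY THE CUT IS NOT COSMETIC (recorded for suppliers; nothing of it is used below).  (a) A mean-value argument in link coordinates cannot prove the
row: the straight interpolant of two hierarchically good fields leaves the good set at heights `j ≳ K/3` even in an optimal common gauge (the
non-abelian `t(1−t)[δ∧δ]` flux through level-`j` squares), so every supplier must quotient the orbit directions exactly, which is what the restriction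
does once and for all.  (b) At an orbit-minimising pair the first-order optimality of `k⋆` is the discrete `U`-Coulomb condition (the perturbation
`log(U'_b U_b⁻¹)` is covariantly divergence-free at every site of the box), and divergence-free + curl-small (goodness of both fields) is the elliptic
regime in which the perturbation is automatically sup-small — the perturbative regime of [Balaban1985Averaging] Props. 3–5, (156)–(163).

WHAT THIS IS NOT: the restricted row is NOT proved here; nothing here proves `stub_iteratedLipschitz`, the crux `BlockLipschitzL`, the crux
`HistoryTailL`, rung R3 (YM₃ on T³ — not d = 4, not infinite volume, not a mass gap, not the Clay problem) or a summit statement.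
Width seat ym-ust-19936-w5 g10 (cell ym3-torus), `--supports stmt-QuantumFields-19936`.
-/

noncomputable section

open scoped BigOperators Matrix.Norms.L2Operator

namespace Summit.QuantumFields.YangMills.Theorems.PoincareLipschitzAvgStabilityOrbitMin

open Literature.MathematicalPhysics.QuantumFieldTheory.Balaban1983to89
open Literature.MathematicalPhysics.QuantumFieldTheory.Balaban1983to89.T3ContinuumYM3Torus
open Literature.MathematicalPhysics.QuantumFieldTheory.Balaban1983to89.T3UnitLawDensityEML
open T4Continuum BlockAveraging AveragingRT T3UnitScaleTilt
open Summit.QuantumFields.YangMills.Theorems.PoincareLipschitzIteratedOfAvgStability (stub_iteratedLipschitz_of_avgStabilityModGauge)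

/-! ## §1 Letters: orbit-invariance of the local goodness, orbit minimisers -/

section Letters

variable {P : Params} {j : ℕ} {G : Type*} [GaugeGroup G]

/-- **THE AVERAGED PLAQUETTE VARIABLES ARE ORBIT FUNCTIONS**: `dist1 (Ū^i(U^k)(∂q)) = dist1 (Ū^i(U)(∂q))` for every level-zero gauge transformation `k`
(standing range `i ≤ m + K`; ✓`iter_gaugeAct`, `plaqHol_gaugeAct`, `dist1_conj`). [cite: Balaban1985Averaging, (11)–(12) p.19] -/
theorem dist1_plaqHol_iter_gaugeAct (av : ∀ i, Averaging P i G) {i : ℕ} (hi : i ≤ P.m + P.K) (k : GaugeTransf P 0 G)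
    (U : GaugeField P 0 G) (q : Plaq P i) :
    dist1 (GaugeField.plaqHol (Averaging.iter av i (GaugeField.gaugeAct k U)) q) =
      dist1 (GaugeField.plaqHol (Averaging.iter av i U) q) := by
  rw [iter_gaugeAct av k i hi U, T4WilsonGaugeFlatDirection.plaqHol_gaugeAct, GaugeGroup.dist1_conj]

end Letters

section Minimiser

variable {P : Params}

/-- A continuous real function on the compact group of level-zero gauge transformations `(Site → SU(2))` attains its minimum. [folklore] -/
theorem exists_forall_le_of_continuous (f : GaugeTransf P 0 (Matrix.specialUnitaryGroup (Fin 2) ℂ) → ℝ)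
    (hf : Continuous (fun k : Site P 0 → Matrix.specialUnitaryGroup (Fin 2) ℂ => f k)) :
    ∃ k₀ : GaugeTransf P 0 (Matrix.specialUnitaryGroup (Fin 2) ℂ), ∀ k, f k₀ ≤ f k := by
  haveI : CompactSpace (Site P 0 → Matrix.specialUnitaryGroup (Fin 2) ℂ) := inferInstance
  obtain ⟨k₀, -, hk₀⟩ := (isCompact_univ (X := Site P 0 → Matrix.specialUnitaryGroup (Fin 2) ℂ)).exists_isMinOn
    Set.univ_nonempty hf.continuousOn
  exact ⟨k₀, fun k => hk₀ (Set.mem_univ k)⟩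

/-- The squared box distance `k ↦ Σ_b 𝟙_box(b)·dist1(U_b ((U'^k)_b)⁻¹)²` is continuous in the gauge transformation `k`. [folklore] -/
theorem continuous_boxDistSq (box : PBond P 0 → Prop) [DecidablePred box]
    (U U' : GaugeField P 0 (Matrix.specialUnitaryGroup (Fin 2) ℂ)) :
    Continuous (fun k : Site P 0 → Matrix.specialUnitaryGroup (Fin 2) ℂ =>
      ∑ b : PBond P 0, if box b then dist1 (U b * (GaugeField.gaugeAct k U' b)⁻¹) ^ 2 else 0) := by
  refine continuous_finsetSum _ fun b _ => ?_
  by_cases hb : box b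
  · simp only [hb, ↓reduceIte]
    have hk : Continuous (fun k : Site P 0 → Matrix.specialUnitaryGroup (Fin 2) ℂ => GaugeField.gaugeAct k U' b) := by
      show Continuous (fun k : Site P 0 → Matrix.specialUnitaryGroup (Fin 2) ℂ => k b.src * U' b * (k b.tgt)⁻¹)
      exact ((continuous_apply b.src).mul continuous_const).mul (continuous_apply b.tgt).inv
    -- `dist1 = ‖· − 1‖_{op}` of the fundamental representation is continuous on `SU(2)`
    have hd : Continuous (dist1 : Matrix.specialUnitaryGroup (Fin 2) ℂ → ℝ) :=
      UnitaryModel.continuous_opDist1.comp (Literature.MathematicalPhysics.QuantumLattice.continuous_fundamentalRep (Fin 2))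
    exact (hd.comp (continuous_const.mul hk.inv)).pow 2
  · simp only [hb, ↓reduceIte]
    exact continuous_const

/-- **ORBIT MINIMISERS EXIST**: for every pair `(U, U')` of level-zero `SU(2)` fields and every box there is a level-zero gauge transformation `k⋆`
minimising the squared box distance from `U` over the gauge orbit of `U'`. [folklore] -/
theorem exists_orbitMinimiser (box : PBond P 0 → Prop) [DecidablePred box]
    (U U' : GaugeField P 0 (Matrix.specialUnitaryGroup (Fin 2) ℂ)) :
    ∃ k₀ : GaugeTransf P 0 (Matrix.specialUnitaryGroup (Fin 2) ℂ), ∀ k : GaugeTransf P 0 (Matrix.specialUnitaryGroup (Fin 2) ℂ),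
      (∑ b : PBond P 0, if box b then dist1 (U b * (GaugeField.gaugeAct k₀ U' b)⁻¹) ^ 2 else 0) ≤
        ∑ b : PBond P 0, if box b then dist1 (U b * (GaugeField.gaugeAct k U' b)⁻¹) ^ 2 else 0 :=
  exists_forall_le_of_continuous _ (continuous_boxDistSq box U U')

end Minimiser

/-! ## §2 The row «average stability modulo gauge» from its restriction to orbit-minimising pairs -/

section Door

/-- ★★ **«AVERAGE STABILITY MODULO GAUGE» ⟸ THE SAME ROW ON ORBIT-MINIMISING PAIRS.**  If the displayed row of the K2-TOP door holds for all
locally hierarchically small pairs `(U, U')` in which `U'` is a box-`ℓ²`-closest point of its level-zero gauge orbit to `U`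
(`∀ k, Σ_box dist1(U_b U'_b⁻¹)² ≤ Σ_box dist1(U_b ((U'^k)_b)⁻¹)²`), then it holds for ALL locally hierarchically small pairs, with the SAME constant
`CS` and the same `γ₁` (minimiser `k⋆` of `exists_orbitMinimiser`; goodness of `U'^{k⋆}` by `dist1_plaqHol_iter_gaugeAct`; minimality of the pair
`(U, U'^{k⋆})` by composition of gauge transformations; transport back by `h·(transfUp k⋆ j)` and ✓`iter_gaugeAct`; the `k = 1` competitor).
[cite: Balaban1985Averaging, (11) p.19] -/
theorem avgStabilityModGauge_of_orbitMinimising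
    (hMin : open Literature.MathematicalPhysics.QuantumFieldTheory.Balaban1983to89 Literature.MathematicalPhysics.QuantumFieldTheory.Balaban1983to89.T3ContinuumYM3Torus in ∀ (L : ℕ), ∃ CS : ℝ, 0 ≤ CS ∧ ∀ (b₀ p₀ : ℝ), 0 < b₀ → 2 < p₀ → ∃ γ₁ : ℝ, 0 < γ₁ ∧ γ₁ ≤ 1 ∧ ∀ (F : T3Family) (γ : ℝ), F.L = L → 0 < γ → γ ≤ γ₁ → ∀ (K j : ℕ), 1 ≤ j → j + 3 ≤ K → ∀ (a : Plaq (F.P K) (j + 1)) (U U' : GaugeField (F.P K) 0 (Matrix.specialUnitaryGroup (Fin 2) ℂ)), (∀ (i : ℕ) (q : Plaq (F.P K) i), i < j + 1 → Site.tdist (fun k => ((((q.src k).val * F.L ^ i : ℕ)) : ZMod ((F.P K).sitesPerDir 0))) (fun k => ((((a.src k).val * F.L ^ (j + 1) : ℕ)) : ZMod ((F.P K).sitesPerDir 0))) + 64 * F.L ^ i ≤ 64 * F.L ^ (j + 1) → GaugeGroup.dist1 (GaugeField.plaqHol (Averaging.iter (fun i' => BlockAveraging.blockAvg (P := F.P K)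 (j := i') T3UnitLawDensityEML.ℰp) i U) q) < T3UnitScaleTilt.θBal F.L γ b₀ p₀ (K - i)) → (∀ (i : ℕ) (q : Plaq (F.P K) i), i < j + 1 → Site.tdist (fun k => ((((q.src k).val * F.L ^ i : ℕ)) : ZMod ((F.P K).sitesPerDir 0))) (fun k => ((((a.src k).val * F.L ^ (j + 1) : ℕ)) : ZMod ((F.P K).sitesPerDir 0))) + 64 * F.L ^ i ≤ 64 * F.L ^ (j + 1) → GaugeGroup.dist1 (GaugeField.plaqHol (Averaging.iter (fun i' => BlockAveraging.blockAvg (P := F.P K) (j := i') T3UnitLawDensityEML.ℰp) i U') q) < T3UnitScaleTilt.θBal F.L γ b₀ p₀ (K - i)) → (∀ k : GaugeTransf (F.P K) 0 (Matrix.specialUnitaryGroup (Fin 2) ℂ), (∑ b : PBond (F.P K) 0, if (∀ k, (b.src k - ((((a.src k).val * F.L ^ (j + 1) : ℕ)) : ZMod ((F.P K).sitesPerDir 0)) + ((8 * F.L ^ (j + 1) : ℕ) : ZMod ((F.P K).sitesPerDir 0))).val < 17 * F.L ^ (j + 1)) ∧ (∀ k, (b.tgt k - ((((a.src k).val * F.L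 ^ (j + 1) : ℕ)) : ZMod ((F.P K).sitesPerDir 0)) + ((8 * F.L ^ (j + 1) : ℕ) : ZMod ((F.P K).sitesPerDir 0))).val < 17 * F.L ^ (j + 1)) then GaugeGroup.dist1 (U b * (U' b)⁻¹) ^ 2 else 0) ≤ (∑ b : PBond (F.P K) 0, if (∀ k, (b.src k - ((((a.src k).val * F.L ^ (j + 1) : ℕ)) : ZMod ((F.P K).sitesPerDir 0)) + ((8 * F.L ^ (j + 1) : ℕ) : ZMod ((F.P K).sitesPerDir 0))).val < 17 * F.L ^ (j + 1)) ∧ (∀ k, (b.tgt k - ((((a.src k).val * F.L ^ (j + 1) : ℕ)) : ZMod ((F.P K).sitesPerDir 0)) + ((8 * F.L ^ (j + 1) : ℕ) : ZMod ((F.P K).sitesPerDir 0))).val < 17 * F.L ^ (j + 1)) then GaugeGroup.dist1 (U b * (GaugeField.gaugeAct k U' b)⁻¹) ^ 2 else 0)) → ∃ h : GaugeTransf (F.P K) j (Matrix.specialUnitaryGroup (Fin 2) ℂ), ∀ c : PBond (F.P K) (j + 1), (c = ⟨a.src, a.μ⟩ ∨ c = ⟨a.src.shift a.μ, a.ν⟩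 ∨ c = ⟨a.src.shift a.ν, a.μ⟩ ∨ c = ⟨a.src, a.ν⟩) → ∀ b : PBond (F.P K) j, (blockOf b.src = c.src ∨ blockOf b.src = c.tgt) → (blockOf b.tgt = c.src ∨ blockOf b.tgt = c.tgt) → GaugeGroup.dist1 (Averaging.iter (fun i' => BlockAveraging.blockAvg (P := F.P K) (j := i') T3UnitLawDensityEML.ℰp) j U b * (GaugeField.gaugeAct h (Averaging.iter (fun i' => BlockAveraging.blockAvg (P := F.P K) (j := i') T3UnitLawDensityEML.ℰp) j U') b)⁻¹) ≤ CS / Real.sqrt ((F.L : ℝ) ^ (j + 1)) * Real.sqrt (∑ b : PBond (F.P K) 0, if (∀ k, (b.src k - ((((a.src k).val * F.L ^ (j + 1) : ℕ)) : ZMod ((F.P K).sitesPerDir 0)) + ((8 * F.L ^ (j + 1) : ℕ) : ZMod ((F.P K).sitesPerDir 0))).val < 17 * F.L ^ (j + 1)) ∧ (∀ k, (b.tgt k - ((((a.src k).val * F.L ^ (j + 1) : ℕ)) : ZMod ((F.P K).sitesPerDir 0)) + ((8 * F.L ^ (j + 1) : ℕ) : ZMod ((F.P K).sitesPerDir 0))).val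 < 17 * F.L ^ (j + 1)) then GaugeGroup.dist1 (U b * (U' b)⁻¹) ^ 2 else 0)) :
    open Literature.MathematicalPhysics.QuantumFieldTheory.Balaban1983to89 Literature.MathematicalPhysics.QuantumFieldTheory.Balaban1983to89.T3ContinuumYM3Torus in ∀ (L : ℕ), ∃ CS : ℝ, 0 ≤ CS ∧ ∀ (b₀ p₀ : ℝ), 0 < b₀ → 2 < p₀ → ∃ γ₁ : ℝ, 0 < γ₁ ∧ γ₁ ≤ 1 ∧ ∀ (F : T3Family) (γ : ℝ), F.L = L → 0 < γ → γ ≤ γ₁ → ∀ (K j : ℕ), 1 ≤ j → j + 3 ≤ K → ∀ (a : Plaq (F.P K) (j + 1)) (U U' : GaugeField (F.P K) 0 (Matrix.specialUnitaryGroup (Fin 2) ℂ)), (∀ (i : ℕ) (q : Plaq (F.P K) i), i < j + 1 → Site.tdist (fun k => ((((q.src k).val * F.L ^ i : ℕ)) : ZMod ((F.P K).sitesPerDir 0))) (fun k => ((((a.src k).val * F.L ^ (j + 1) : ℕ)) : ZMod ((F.P K).sitesPerDir 0))) + 64 * F.L ^ i ≤ 64 * F.L ^ (j + 1) → GaugeGroup.dist1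 (GaugeField.plaqHol (Averaging.iter (fun i' => BlockAveraging.blockAvg (P := F.P K) (j := i') T3UnitLawDensityEML.ℰp) i U) q) < T3UnitScaleTilt.θBal F.L γ b₀ p₀ (K - i)) → (∀ (i : ℕ) (q : Plaq (F.P K) i), i < j + 1 → Site.tdist (fun k => ((((q.src k).val * F.L ^ i : ℕ)) : ZMod ((F.P K).sitesPerDir 0))) (fun k => ((((a.src k).val * F.L ^ (j + 1) : ℕ)) : ZMod ((F.P K).sitesPerDir 0))) + 64 * F.L ^ i ≤ 64 * F.L ^ (j + 1) → GaugeGroup.dist1 (GaugeField.plaqHol (Averaging.iter (fun i' => BlockAveraging.blockAvg (P := F.P K) (j := i') T3UnitLawDensityEML.ℰp) i U') q) < T3UnitScaleTilt.θBal F.L γ b₀ p₀ (K - i)) → ∃ h : GaugeTransf (F.P K) j (Matrix.specialUnitaryGroup (Fin 2) ℂ), ∀ c : PBond (F.P K) (j + 1), (c = ⟨a.src, a.μ⟩ ∨ c = ⟨a.src.shift a.μ, a.ν⟩ ∨ c = ⟨a.src.shift a.ν, a.μ⟩ ∨ c = ⟨a.src, a.ν⟩) → ∀ b : PBond (F.P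 K) j, (blockOf b.src = c.src ∨ blockOf b.src = c.tgt) → (blockOf b.tgt = c.src ∨ blockOf b.tgt = c.tgt) → GaugeGroup.dist1 (Averaging.iter (fun i' => BlockAveraging.blockAvg (P := F.P K) (j := i') T3UnitLawDensityEML.ℰp) j U b * (GaugeField.gaugeAct h (Averaging.iter (fun i' => BlockAveraging.blockAvg (P := F.P K) (j := i') T3UnitLawDensityEML.ℰp) j U') b)⁻¹) ≤ CS / Real.sqrt ((F.L : ℝ) ^ (j + 1)) * Real.sqrt (∑ b : PBond (F.P K) 0, if (∀ k, (b.src k - ((((a.src k).val * F.L ^ (j + 1) : ℕ)) : ZMod ((F.P K).sitesPerDir 0)) + ((8 * F.L ^ (j + 1) : ℕ) : ZMod ((F.P K).sitesPerDir 0))).val < 17 * F.L ^ (j + 1)) ∧ (∀ k, (b.tgt k - ((((a.src k).val * F.L ^ (j + 1) : ℕ)) : ZMod ((F.P K).sitesPerDir 0)) + ((8 * F.L ^ (j + 1) : ℕ) : ZMod ((F.P K).sitesPerDir 0))).val < 17 * F.L ^ (j + 1)) then GaugeGroup.dist1 (U b * (U' b)⁻¹) ^ 2 else 0) := by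
  intro L
  obtain ⟨CS, hCS, HS⟩ := hMin L
  refine ⟨CS, hCS, ?_⟩
  intro b₀ p₀ hb hp
  obtain ⟨γ₁, hγ₁, hγ₁1, HS'⟩ := HS b₀ p₀ hb hp
  refine ⟨γ₁, hγ₁, hγ₁1, ?_⟩
  intro F γ hFL hγ hγle K j hj hjK a U U' hU hU'
  have hjr : j ≤ (F.P K).m + (F.P K).K := by
    show j ≤ F.m + K
    have := F.hm
    omega
  -- composition of gauge transformations and the trivial one (inlined letters)
  have hcomp : ∀ (u v : GaugeTransf (F.P K) 0 (Matrix.specialUnitaryGroup (Fin 2) ℂ))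
      (V : GaugeField (F.P K) 0 (Matrix.specialUnitaryGroup (Fin 2) ℂ)),
      GaugeField.gaugeAct u (GaugeField.gaugeAct v V) = GaugeField.gaugeAct (fun x => u x * v x) V := fun u v V => by
    funext b
    simp only [GaugeField.gaugeAct, mul_inv_rev, mul_assoc]
  have hcompj : ∀ (u v : GaugeTransf (F.P K) j (Matrix.specialUnitaryGroup (Fin 2) ℂ))
      (V : GaugeField (F.P K) j (Matrix.specialUnitaryGroup (Fin 2) ℂ)),
      GaugeField.gaugeAct u (GaugeField.gaugeAct v V) = GaugeField.gaugeAct (fun x => u x * v x) V := fun u v V => by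
    funext b
    simp only [GaugeField.gaugeAct, mul_inv_rev, mul_assoc]
  have hone : GaugeField.gaugeAct (fun _ => (1 : Matrix.specialUnitaryGroup (Fin 2) ℂ)) U' = U' := by
    funext b
    simp [GaugeField.gaugeAct]
  -- an orbit minimiser `k₀` for the box of the row
  obtain ⟨k₀, hk₀⟩ := exists_orbitMinimiser (P := F.P K)
    (fun b : PBond (F.P K) 0 => (∀ k, (b.src k - ((((a.src k).val * F.L ^ (j + 1) : ℕ)) : ZMod ((F.P K).sitesPerDir 0)) + ((8 * F.L ^ (j + 1) : ℕ) : ZMod ((F.P K).sitesPerDir 0))).val < 17 * F.L ^ (j + 1)) ∧ (∀ k, (b.tgt k - ((((a.src k).val * F.L ^ (j + 1) : ℕ)) : ZMod ((F.P K).sitesPerDir 0)) + ((8 * F.L ^ (j + 1) : ℕ) : ZMod ((F.P K).sitesPerDir 0))).val < 17 * F.L ^ (j + 1))) U U'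
  -- the re-gauged field is locally good
  have hU'k : (∀ (i : ℕ) (q : Plaq (F.P K) i), i < j + 1 → Site.tdist (fun k => ((((q.src k).val * F.L ^ i : ℕ)) : ZMod ((F.P K).sitesPerDir 0))) (fun k => ((((a.src k).val * F.L ^ (j + 1) : ℕ)) : ZMod ((F.P K).sitesPerDir 0))) + 64 * F.L ^ i ≤ 64 * F.L ^ (j + 1) → GaugeGroup.dist1 (GaugeField.plaqHol (Averaging.iter (fun i' => BlockAveraging.blockAvg (P := F.P K) (j := i') T3UnitLawDensityEML.ℰp) i (GaugeField.gaugeAct k₀ U')) q) < T3UnitScaleTilt.θBal F.L γ b₀ p₀ (K - i)) := by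
    intro i q hi hq
    have hir : i ≤ (F.P K).m + (F.P K).K := by omega
    rw [dist1_plaqHol_iter_gaugeAct (fun i' => BlockAveraging.blockAvg (P := F.P K) (j := i') T3UnitLawDensityEML.ℰp) hir k₀ U' q]
    exact hU' i q hi hq
  -- the re-gauged pair is orbit-minimising
  have hmin : ∀ k : GaugeTransf (F.P K) 0 (Matrix.specialUnitaryGroup (Fin 2) ℂ),
      (∑ b : PBond (F.P K) 0, if (∀ k, (b.src k - ((((a.src k).val * F.L ^ (j + 1) : ℕ)) : ZMod ((F.P K).sitesPerDir 0)) + ((8 * F.L ^ (j + 1) : ℕ) : ZMod ((F.P K).sitesPerDir 0))).val < 17 * F.L ^ (j + 1)) ∧ (∀ k, (b.tgt k - ((((a.src k).val * F.L ^ (j + 1) : ℕ)) : ZMod ((F.P K).sitesPerDir 0)) + ((8 * F.L ^ (j + 1) : ℕ) : ZMod ((F.P K).sitesPerDir 0))).val < 17 * F.L ^ (j + 1)) then GaugeGroup.dist1 (U b * (GaugeField.gaugeAct k₀ U' b)⁻¹) ^ 2 else 0) ≤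
        (∑ b : PBond (F.P K) 0, if (∀ k, (b.src k - ((((a.src k).val * F.L ^ (j + 1) : ℕ)) : ZMod ((F.P K).sitesPerDir 0)) + ((8 * F.L ^ (j + 1) : ℕ) : ZMod ((F.P K).sitesPerDir 0))).val < 17 * F.L ^ (j + 1)) ∧ (∀ k, (b.tgt k - ((((a.src k).val * F.L ^ (j + 1) : ℕ)) : ZMod ((F.P K).sitesPerDir 0)) + ((8 * F.L ^ (j + 1) : ℕ) : ZMod ((F.P K).sitesPerDir 0))).val < 17 * F.L ^ (j + 1)) then GaugeGroup.dist1 (U b * (GaugeField.gaugeAct k (GaugeField.gaugeAct k₀ U') b)⁻¹) ^ 2 else 0) := by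
    intro k
    rw [hcomp]
    exact hk₀ _
  obtain ⟨h, hh⟩ := HS' F γ hFL hγ hγle K j hj hjK a U (GaugeField.gaugeAct k₀ U') hU hU'k hmin
  refine ⟨fun y => h y * transfUp k₀ j y, ?_⟩
  intro c hc b hbs hbt
  have key := hh c hc b hbs hbt
  rw [iter_gaugeAct (fun i' => BlockAveraging.blockAvg (P := F.P K) (j := i') T3UnitLawDensityEML.ℰp) k₀ j hjr U',
    hcompj] at key
  refine key.trans (mul_le_mul_of_nonneg_left (Real.sqrt_le_sqrt ?_) (div_nonneg hCS (Real.sqrt_nonneg _)))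
  have h1 := hk₀ (fun _ => 1)
  rw [hone] at h1
  exact h1

end Door

/-! ## §3 The registered stub from the restricted row -/

section Stub

/-- ★ **`stub_iteratedLipschitz` ⟸ «AVERAGE STABILITY MODULO GAUGE ON ORBIT-MINIMISING PAIRS»** (VERBATIM registered signature of
`Cruxes/HistoryTailL/Lines/poincare_lipschitz.lean`, `CL := 484·L·CS`): `avgStabilityModGauge_of_orbitMinimising` followed by the K2-TOP door
✓`stub_iteratedLipschitz_of_avgStabilityModGauge`. [cite: Balaban1987RG1, (0.4) p.253; Balaban1985Averaging, (11) p.19] -/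
theorem stub_iteratedLipschitz_of_avgStabilityOrbitMin
    (hMin : open Literature.MathematicalPhysics.QuantumFieldTheory.Balaban1983to89 Literature.MathematicalPhysics.QuantumFieldTheory.Balaban1983to89.T3ContinuumYM3Torus in ∀ (L : ℕ), ∃ CS : ℝ, 0 ≤ CS ∧ ∀ (b₀ p₀ : ℝ), 0 < b₀ → 2 < p₀ → ∃ γ₁ : ℝ, 0 < γ₁ ∧ γ₁ ≤ 1 ∧ ∀ (F : T3Family) (γ : ℝ), F.L = L → 0 < γ → γ ≤ γ₁ → ∀ (K j : ℕ), 1 ≤ j → j + 3 ≤ K → ∀ (a : Plaq (F.P K) (j + 1)) (U U' : GaugeField (F.P K) 0 (Matrix.specialUnitaryGroup (Fin 2) ℂ)), (∀ (i : ℕ) (q : Plaq (F.P K) i), i < j + 1 → Site.tdist (fun k => ((((q.src k).val * F.L ^ i : ℕ)) : ZMod ((F.P K).sitesPerDir 0))) (fun k => ((((a.src k).val * F.L ^ (j + 1) : ℕ)) : ZMod ((F.P K).sitesPerDir 0))) + 64 * F.L ^ i ≤ 64 * F.L ^ (j + 1) → GaugeGroup.dist1 (GaugeField.plaqHol (Averaging.iter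 (fun i' => BlockAveraging.blockAvg (P := F.P K) (j := i') T3UnitLawDensityEML.ℰp) i U) q) < T3UnitScaleTilt.θBal F.L γ b₀ p₀ (K - i)) → (∀ (i : ℕ) (q : Plaq (F.P K) i), i < j + 1 → Site.tdist (fun k => ((((q.src k).val * F.L ^ i : ℕ)) : ZMod ((F.P K).sitesPerDir 0))) (fun k => ((((a.src k).val * F.L ^ (j + 1) : ℕ)) : ZMod ((F.P K).sitesPerDir 0))) + 64 * F.L ^ i ≤ 64 * F.L ^ (j + 1) → GaugeGroup.dist1 (GaugeField.plaqHol (Averaging.iter (fun i' => BlockAveraging.blockAvg (P := F.P K) (j := i') T3UnitLawDensityEML.ℰp) i U') q) < T3UnitScaleTilt.θBal F.L γ b₀ p₀ (K - i)) → (∀ k : GaugeTransf (F.P K) 0 (Matrix.specialUnitaryGroup (Fin 2) ℂ), (∑ b : PBond (F.P K) 0, if (∀ k, (b.src k - ((((a.src k).val * F.L ^ (j + 1) : ℕ)) : ZMod ((F.P K).sitesPerDir 0)) + ((8 * F.L ^ (j + 1) : ℕ) : ZMod ((F.P K).sitesPerDir 0))).val < 17 * F.L ^ (j + 1)) ∧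 (∀ k, (b.tgt k - ((((a.src k).val * F.L ^ (j + 1) : ℕ)) : ZMod ((F.P K).sitesPerDir 0)) + ((8 * F.L ^ (j + 1) : ℕ) : ZMod ((F.P K).sitesPerDir 0))).val < 17 * F.L ^ (j + 1)) then GaugeGroup.dist1 (U b * (U' b)⁻¹) ^ 2 else 0) ≤ (∑ b : PBond (F.P K) 0, if (∀ k, (b.src k - ((((a.src k).val * F.L ^ (j + 1) : ℕ)) : ZMod ((F.P K).sitesPerDir 0)) + ((8 * F.L ^ (j + 1) : ℕ) : ZMod ((F.P K).sitesPerDir 0))).val < 17 * F.L ^ (j + 1)) ∧ (∀ k, (b.tgt k - ((((a.src k).val * F.L ^ (j + 1) : ℕ)) : ZMod ((F.P K).sitesPerDir 0)) + ((8 * F.L ^ (j + 1) : ℕ) : ZMod ((F.P K).sitesPerDir 0))).val < 17 * F.L ^ (j + 1)) then GaugeGroup.dist1 (U b * (GaugeField.gaugeAct k U' b)⁻¹) ^ 2 else 0)) → ∃ h : GaugeTransf (F.P K) j (Matrix.specialUnitaryGroup (Fin 2) ℂ), ∀ c : PBond (F.P K) (j + 1), (c = ⟨a.src, a.μ⟩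 ∨ c = ⟨a.src.shift a.μ, a.ν⟩ ∨ c = ⟨a.src.shift a.ν, a.μ⟩ ∨ c = ⟨a.src, a.ν⟩) → ∀ b : PBond (F.P K) j, (blockOf b.src = c.src ∨ blockOf b.src = c.tgt) → (blockOf b.tgt = c.src ∨ blockOf b.tgt = c.tgt) → GaugeGroup.dist1 (Averaging.iter (fun i' => BlockAveraging.blockAvg (P := F.P K) (j := i') T3UnitLawDensityEML.ℰp) j U b * (GaugeField.gaugeAct h (Averaging.iter (fun i' => BlockAveraging.blockAvg (P := F.P K) (j := i') T3UnitLawDensityEML.ℰp) j U') b)⁻¹) ≤ CS / Real.sqrt ((F.L : ℝ) ^ (j + 1)) * Real.sqrt (∑ b : PBond (F.P K) 0, if (∀ k, (b.src k - ((((a.src k).val * F.L ^ (j + 1) : ℕ)) : ZMod ((F.P K).sitesPerDir 0)) + ((8 * F.L ^ (j + 1) : ℕ) : ZMod ((F.P K).sitesPerDir 0))).val < 17 * F.L ^ (j + 1)) ∧ (∀ k, (b.tgt k - ((((a.src k).val * F.L ^ (j + 1) : ℕ)) : ZMod ((F.P K).sitesPerDir 0)) + ((8 * F.L ^ (j + 1)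 : ℕ) : ZMod ((F.P K).sitesPerDir 0))).val < 17 * F.L ^ (j + 1)) then GaugeGroup.dist1 (U b * (U' b)⁻¹) ^ 2 else 0)) :
    open Literature.MathematicalPhysics.QuantumFieldTheory.Balaban1983to89 Literature.MathematicalPhysics.QuantumFieldTheory.Balaban1983to89.T3ContinuumYM3Torus in ∀ (L : ℕ), ∃ CL : ℝ, 0 ≤ CL ∧ ∀ (b₀ p₀ : ℝ), 0 < b₀ → 2 < p₀ → ∃ γ₁ : ℝ, 0 < γ₁ ∧ γ₁ ≤ 1 ∧ ∀ (F : T3Family) (γ : ℝ), F.L = L → 0 < γ → γ ≤ γ₁ → ∀ (K j : ℕ), 1 ≤ j → j + 2 ≤ K → 2 ≤ j → ∀ (a : Plaq (F.P K) j) (U U' : GaugeField (F.P K) 0 (Matrix.specialUnitaryGroup (Fin 2) ℂ)), (∀ (i : ℕ) (q : Plaq (F.P K) i), i < j → Site.tdist (fun k => ((((q.src k).val * F.L ^ i : ℕ)) : ZMod ((F.P K).sitesPerDir 0))) (fun k => ((((a.src k).val * F.L ^ j : ℕ)) : ZMod ((F.P K).sitesPerDir 0))) + 64 * F.L ^ i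 ≤ 64 * F.L ^ j → GaugeGroup.dist1 (GaugeField.plaqHol (Averaging.iter (fun i' => BlockAveraging.blockAvg (P := F.P K) (j := i') T3UnitLawDensityEML.ℰp) i U) q) < T3UnitScaleTilt.θBal F.L γ b₀ p₀ (K - i)) → (∀ (i : ℕ) (q : Plaq (F.P K) i), i < j → Site.tdist (fun k => ((((q.src k).val * F.L ^ i : ℕ)) : ZMod ((F.P K).sitesPerDir 0))) (fun k => ((((a.src k).val * F.L ^ j : ℕ)) : ZMod ((F.P K).sitesPerDir 0))) + 64 * F.L ^ i ≤ 64 * F.L ^ j → GaugeGroup.dist1 (GaugeField.plaqHol (Averaging.iter (fun i' => BlockAveraging.blockAvg (P := F.P K) (j := i') T3UnitLawDensityEML.ℰp) i U') q) < T3UnitScaleTilt.θBal F.L γ b₀ p₀ (K - i)) → |GaugeGroup.dist1 (GaugeField.plaqHol (Averaging.iter (fun i' => BlockAveraging.blockAvg (P := F.P K) (j := i') T3UnitLawDensityEML.ℰp) j U) a) - GaugeGroup.dist1 (GaugeField.plaqHol (Averaging.iter (fun i' => BlockAveraging.blockAvg (P := F.P K) (j := i') T3UnitLawDensityEML.ℰp)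 j U') a)| ≤ CL / Real.sqrt ((F.L : ℝ) ^ j) * Real.sqrt (∑ b : PBond (F.P K) 0, if (∀ k, (b.src k - ((((a.src k).val * F.L ^ j : ℕ)) : ZMod ((F.P K).sitesPerDir 0)) + ((8 * F.L ^ j : ℕ) : ZMod ((F.P K).sitesPerDir 0))).val < 17 * F.L ^ j) ∧ (∀ k, (b.tgt k - ((((a.src k).val * F.L ^ j : ℕ)) : ZMod ((F.P K).sitesPerDir 0)) + ((8 * F.L ^ j : ℕ) : ZMod ((F.P K).sitesPerDir 0))).val < 17 * F.L ^ j) then GaugeGroup.dist1 (U b * (U' b)⁻¹) ^ 2 else 0) :=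
  stub_iteratedLipschitz_of_avgStabilityModGauge (avgStabilityModGauge_of_orbitMinimising hMin)

end Stub

end Summit.QuantumFields.YangMills.Theorems.PoincareLipschitzAvgStabilityOrbitMin
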